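import Summits.Parity.GeneralizedHardyLittlewood.Theorems.PrimeLevelFamEdgeMomentsBeyondDiagonalDiagDecorM8Coprime
import Summits.Parity.GeneralizedHardyLittlewood.Theorems.PrimeLevelFamEdgeMomentsBeyondDiagonalDiagDecorM4Coord
import Summits.Parity.GeneralizedHardyLittlewood.Theorems.PrimeLevelFamEdgeMomentsBeyondDiagonalDiagDecorMasterInputsLog
import HarnessLib

/-!
# Route `PrimeLevelFamEdge`, crux K_A `MomentsBeyondDiagonal` (stmt-Parity-20007), line «petersson_layers» v4, stub `stub_diag`:
# **the `M₈`-decorated shifted Selberg COORDINATE is `O(D(n)(1+κ(n))·log^{r+5}M)`** — the profile layer over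
# `…DiagDecorM8Coprime.abs_coprimeSumPow_M8_le` (the `M₈`-twin of `…DiagDecorM4Coord` / `…DiagDecorM6Coord`)

For order `(4,4)` of `stub_diag` the new one-sided decoration is `D = 105P₂⁴ − 420P₂²P₄ + 448P₂P₆ + 140P₄² − 272P₈` (`M₈ = τ·D`
on squarefree numbers, `…DiagDecorWeightRungFour.centralMoment_eight_of_squarefree`). Its shifted Selberg coordinate
`T_D^{[r]}(M;n) = Σ_c P_c·(Σ_{k≤M/n,(k,n)=1} W(k)τ(k)D(k)·log^{c+r}((M/n)/k))/logᶜM` has NO main term and the crude size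

* `abs_shiftedCoordM8_le` — **`|T_D^{[r]}(M;n)| ≤ K·D(n)(1+κ(n))·log^{r+5}M`** (`P₀ = P₁ = 0`, `M ≥ 3`, `1 ≤ n ≤ M`; from
  `abs_coprimeSumPow_M8_le` at `y = M/n`, `(1+log(M/n))^{c+r+5} ≤ (2 log M)^{c+r+5}`).

The remaining `M₈` layers (collapse / block / family, `|Sel(τD(k₁)·τ(k₂)·L^m)| ≤ C log^{m+4}M`) are the `M₆` files
`…DiagDecorM6Collapse/Block/Family` with this coordinate size (two logarithms higher). Def-free; theorems only. Helper
`--supports stmt-Parity-20007`; closes nothing; K_A, K_B and the Parity summit are NOT proved; nothing about Landau–Siegel zeros.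

## References
* E. Kowalski, P. Michel, J. VanderKam, J. reine angew. Math. 526 (2000), (23)–(28) pp. 13–15 and Prop. 5.1 p. 18.
  [cite: KowalskiMichelVanderKam2000, (23)–(28) — derivation (eighth central divisor-log moment of the Selberg coordinates)]
-/

noncomputable section

open scoped Real
open Finset ArithmeticFunction Polynomial

namespace Summit.Parity.GeneralizedHardyLittlewood.Theorems.MomentsBeyondDiagonal.DiagKernel

open Literature.NumberTheory.LFunctions Literature.NumberTheory.LFunctions.KMV2000
open MollifierMainTerm (W)
open SelbergCoord (kappa)
open Literature.NumberTheory.Sieve (one_le_log_of_three_le)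
open Summit.Parity.GeneralizedHardyLittlewood.Theorems.BeyondDiagonalBeatsQuarter.KernelFormXSq
  (copTauW copTauW_apply mainConst divWeight divWeight_nonneg)

/-- **The `M₈`-decorated shifted coordinate is `O(D(n)(1+κ(n))log^{r+5}M)`** (`P₀ = P₁ = 0`; for every `r` there is `K ≥ 0`
with the bound for all `M ≥ 3`, `1 ≤ n ≤ M`). [cite: KowalskiMichelVanderKam2000, (23)–(28) — derivation] -/
theorem abs_shiftedCoordM8_le (P : ℝ[X]) (hP0 : P.coeff 0 = 0) (hP1 : P.coeff 1 = 0) (r : ℕ) :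
    ∃ K : ℝ, 0 ≤ K ∧ ∀ M : ℝ, 3 ≤ M → ∀ n : ℕ, n ≠ 0 → (n : ℝ) ≤ M →
      |∑ c ∈ Finset.range (P.natDegree + 1), P.coeff c *
          ((∑ k ∈ Icc 1 ⌊M / n⌋₊, (if k.Coprime n then W k else 0) *
              ((k.divisors.card : ℝ) *
                (105 * (∑ p ∈ k.primeFactors, Real.log p ^ 2) ^ 4 -
            420 * (∑ p ∈ k.primeFactors, Real.log p ^ 2) ^ 2 * (∑ p ∈ k.primeFactors, Real.log p ^ 4) +
            448 * (∑ p ∈ k.primeFactors, Real.log p ^ 2) * (∑ p ∈ k.primeFactors, Real.log p ^ 6) +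
            140 * (∑ p ∈ k.primeFactors, Real.log p ^ 4) ^ 2 -
            272 * ∑ p ∈ k.primeFactors, Real.log p ^ 8)) *
            Real.log (M / n / k) ^ (c + r)) / Real.log M ^ c)| ≤
        K * divWeight n * (1 + kappa n) * Real.log M ^ (r + 5) := by
  -- one engine constant per `c ≥ 2`
  have hex : ∀ c : ℕ, ∃ C : ℝ, 0 < C ∧ (2 ≤ c → ∀ n : ℕ, n ≠ 0 → ∀ y : ℝ, 1 ≤ y →
      |∑ k ∈ Icc 1 ⌊y⌋₊, copTauW n k * Real.log (y / k) ^ (c + r) *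
          (105 * (∑ p ∈ k.primeFactors, Real.log p ^ 2) ^ 4 -
            420 * (∑ p ∈ k.primeFactors, Real.log p ^ 2) ^ 2 * (∑ p ∈ k.primeFactors, Real.log p ^ 4) +
            448 * (∑ p ∈ k.primeFactors, Real.log p ^ 2) * (∑ p ∈ k.primeFactors, Real.log p ^ 6) +
            140 * (∑ p ∈ k.primeFactors, Real.log p ^ 4) ^ 2 -
            272 * ∑ p ∈ k.primeFactors, Real.log p ^ 8)| ≤
        C * divWeight n * (1 + kappa n) * (1 + Real.log y) ^ (c + r + 5)) := by
    intro c
    by_cases hc : 2 ≤ c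
    · obtain ⟨C, hC, h⟩ := abs_coprimeSumPow_M8_le (show 2 ≤ c + r by omega)
      exact ⟨C, hC, fun _ ↦ h⟩
    · exact ⟨1, one_pos, fun h ↦ absurd h hc⟩
  choose Cc hCc0 hCc using hex
  set K : ℝ := ∑ c ∈ Finset.range (P.natDegree + 1), |P.coeff c| * Cc c * 2 ^ (c + r + 5) with hK
  have hK0 : 0 ≤ K := Finset.sum_nonneg fun c _ ↦ by have := hCc0 c; positivity
  refine ⟨K, hK0, fun M hM n hn hnM ↦ ?_⟩
  set ℓ := Real.log M with hℓ
  have hℓ1 : 1 ≤ ℓ := one_le_log_of_three_le hM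
  have hℓ0 : 0 < ℓ := by linarith
  have hD := divWeight_nonneg n
  have hκ : 0 ≤ kappa n := by
    unfold kappa
    exact Finset.sum_nonneg fun p hp ↦ by
      have hp2 : (2 : ℝ) ≤ p := by exact_mod_cast (Nat.prime_of_mem_primeFactors hp).two_le
      exact div_nonneg (Real.log_nonneg (by linarith)) (by linarith)
  obtain ⟨hY0, hYℓ⟩ := log_div_nonneg_and_le hM hn hnM
  have hn0 : (0 : ℝ) < n := by exact_mod_cast Nat.pos_of_ne_zero hn
  have hy1 : 1 ≤ M / n := (one_le_div hn0).2 hnM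
  -- termwise
  have hterm : ∀ c ∈ Finset.range (P.natDegree + 1),
      |P.coeff c * ((∑ k ∈ Icc 1 ⌊M / n⌋₊, (if k.Coprime n then W k else 0) *
          ((k.divisors.card : ℝ) *
            (105 * (∑ p ∈ k.primeFactors, Real.log p ^ 2) ^ 4 -
            420 * (∑ p ∈ k.primeFactors, Real.log p ^ 2) ^ 2 * (∑ p ∈ k.primeFactors, Real.log p ^ 4) +
            448 * (∑ p ∈ k.primeFactors, Real.log p ^ 2) * (∑ p ∈ k.primeFactors, Real.log p ^ 6) +
            140 * (∑ p ∈ k.primeFactors, Real.log p ^ 4) ^ 2 -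
            272 * ∑ p ∈ k.primeFactors, Real.log p ^ 8)) *
          Real.log (M / n / k) ^ (c + r)) / ℓ ^ c)| ≤
        |P.coeff c| * Cc c * 2 ^ (c + r + 5) * (divWeight n * (1 + kappa n) * ℓ ^ (r + 5)) := by
    intro c _
    by_cases hPc : P.coeff c = 0
    · rw [hPc, zero_mul, abs_zero]
      simp
    · have hc2 : 2 ≤ c := by
        rcases Nat.lt_or_ge c 2 with h | h
        · interval_cases c
          · exact absurd hP0 hPc
          · exact absurd hP1 hPc
        · exact h
      have hre : ∑ k ∈ Icc 1 ⌊M / n⌋₊, (if k.Coprime n then W k else 0) *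
            ((k.divisors.card : ℝ) *
              (105 * (∑ p ∈ k.primeFactors, Real.log p ^ 2) ^ 4 -
            420 * (∑ p ∈ k.primeFactors, Real.log p ^ 2) ^ 2 * (∑ p ∈ k.primeFactors, Real.log p ^ 4) +
            448 * (∑ p ∈ k.primeFactors, Real.log p ^ 2) * (∑ p ∈ k.primeFactors, Real.log p ^ 6) +
            140 * (∑ p ∈ k.primeFactors, Real.log p ^ 4) ^ 2 -
            272 * ∑ p ∈ k.primeFactors, Real.log p ^ 8)) *
            Real.log (M / n / k) ^ (c + r) =
          ∑ k ∈ Icc 1 ⌊M / n⌋₊, copTauW n k * Real.log (M / n / k) ^ (c + r) *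
            (105 * (∑ p ∈ k.primeFactors, Real.log p ^ 2) ^ 4 -
            420 * (∑ p ∈ k.primeFactors, Real.log p ^ 2) ^ 2 * (∑ p ∈ k.primeFactors, Real.log p ^ 4) +
            448 * (∑ p ∈ k.primeFactors, Real.log p ^ 2) * (∑ p ∈ k.primeFactors, Real.log p ^ 6) +
            140 * (∑ p ∈ k.primeFactors, Real.log p ^ 4) ^ 2 -
            272 * ∑ p ∈ k.primeFactors, Real.log p ^ 8) :=
        Finset.sum_congr rfl fun k _ ↦ by rw [copW_mul_card_mul_eq]; ring
      have hS := hCc c hc2 n hn (M / n) hy1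
      rw [← hre] at hS
      have h2ℓ : (1 + Real.log (M / n)) ^ (c + r + 5) ≤ (2 * ℓ) ^ (c + r + 5) :=
        pow_le_pow_left₀ (by linarith) (by linarith) _
      rw [abs_mul, abs_div, abs_of_pos (pow_pos hℓ0 c)]
      have hCc := hCc0 c
      have hB := hS.trans (show Cc c * divWeight n * (1 + kappa n) * (1 + Real.log (M / n)) ^ (c + r + 5) ≤
          (Cc c * 2 ^ (c + r + 5) * (divWeight n * (1 + kappa n) * ℓ ^ (r + 5))) * ℓ ^ c from by
        calc Cc c * divWeight n * (1 + kappa n) * (1 + Real.log (M / n)) ^ (c + r + 5)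
            ≤ Cc c * divWeight n * (1 + kappa n) * (2 * ℓ) ^ (c + r + 5) := by gcongr
          _ = (Cc c * 2 ^ (c + r + 5) * (divWeight n * (1 + kappa n) * ℓ ^ (r + 5))) * ℓ ^ c := by ring)
      have hB' := (div_le_iff₀ (pow_pos hℓ0 c)).2 hB
      calc _ ≤ |P.coeff c| * (Cc c * 2 ^ (c + r + 5) * (divWeight n * (1 + kappa n) * ℓ ^ (r + 5))) :=
            mul_le_mul_of_nonneg_left hB' (abs_nonneg _)
        _ = _ := by ring
  calc _ ≤ ∑ c ∈ Finset.range (P.natDegree + 1), |P.coeff c * ((∑ k ∈ Icc 1 ⌊M / n⌋₊, (if k.Coprime n then W k else 0) *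
          ((k.divisors.card : ℝ) *
            (105 * (∑ p ∈ k.primeFactors, Real.log p ^ 2) ^ 4 -
            420 * (∑ p ∈ k.primeFactors, Real.log p ^ 2) ^ 2 * (∑ p ∈ k.primeFactors, Real.log p ^ 4) +
            448 * (∑ p ∈ k.primeFactors, Real.log p ^ 2) * (∑ p ∈ k.primeFactors, Real.log p ^ 6) +
            140 * (∑ p ∈ k.primeFactors, Real.log p ^ 4) ^ 2 -
            272 * ∑ p ∈ k.primeFactors, Real.log p ^ 8)) *
          Real.log (M / n / k) ^ (c + r)) / ℓ ^ c)| := Finset.abs_sum_le_sum_abs _ _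
    _ ≤ ∑ c ∈ Finset.range (P.natDegree + 1), |P.coeff c| * Cc c * 2 ^ (c + r + 5) *
          (divWeight n * (1 + kappa n) * ℓ ^ (r + 5)) := Finset.sum_le_sum hterm
    _ = K * divWeight n * (1 + kappa n) * ℓ ^ (r + 5) := by
        rw [hK, Finset.sum_mul, Finset.sum_mul, Finset.sum_mul]
        exact Finset.sum_congr rfl fun c _ ↦ by ring

end Summit.Parity.GeneralizedHardyLittlewood.Theorems.MomentsBeyondDiagonal.DiagKernel

end
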